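import Mathlib
import Summits.KontsevichZagierPeriods.Zeta5Search.UniversalDigitV
import Summits.KontsevichZagierPeriods.Zeta5Search.GHatConj
import Summits.KontsevichZagierPeriods.Zeta5Search.RecordCellADigitsA
import HarnessLib

/-!
# ζ(5) search — TYPE INVARIANCE of the first digits: the class data of a level class depend only on its exponent vector

Cell `pub-zeta5` (HONEST FRAMING: systematic search; no irrationality claim unless certified), P1 prover seat
generation 6.  A LEVEL CLASS is a residue class `{x, x+p, …, x+Lp}` (`x < p ≤ …`, `x + Lp ≤ b₀ < x + (L+1)p`) not
containing the centre residue; its TYPE is the exponent vector `e = (e₀,…,e_L)`, `e_k = netExp b (x + kp)`.  For such a class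
the partial-fraction cofactor data `ρ_{q,σ} = classRho`, the `W`-digit `ŵ_x = CellA.wHat`, the `V`-digit `v̂_x = CellA.vHat` and
the class exponent `E_x` are the values `typeRho`, `typeW`, `typeV`, `typeExp` of CLOSED expressions in the type alone
(`classRho_level`, `wHat_level`, `vHat_level`, `classExp_level`: the level differences `(q − s)/p` are the integers `i − j` and the
levels `⌊q/p⌋` are `0,…,L`) — gen-2 g9's remark "`ρ_{q,σ}`, `ℓ_q`, `H^{(σ)}_{ℓ_q}` are functions of `(T_x, ℓ_q, σ)` only"
(REPORT-gen2-g9 §1.1) made formal.  Consequently P1 g5's universal digits `wDigit` / `vDigit` read, in normalised form,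
  `‖(−p)^{−(E+3)}·W_x − ĝ·ŵ(T)‖_p ≤ p⁻¹`,   `‖(−p)^{−E}·V_x − ĝ·v̂(T)‖_p ≤ p⁻¹`
for ANY `p`-adic approximation `ĝ` of the class unit (`w_digit_level`, `v_digit_level`), and the unit of the conjugate class
`b₀ − (x + Lp)` is `(−1)^{E+1}ĝ_x` up to `O(p)` (`gHat_conj_level`, from G1/G2).  This is the digit layer of the Lean proof of
census g11's `RecordCellD` (types `(1,−1,−6,−3,1)`, `(1,−3,−6,−1,1)`, `(1,−2,−6,−2,1)`), usable for every cell whose minimal classes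
are level classes; the type constants are never evaluated.  `p`-adic valuations of rational numbers; nothing about irrationality.
-/

noncomputable section

open Finset PowerSeries

namespace Summit.KontsevichZagierPeriods.Zeta5Search.LevelClass

open Summit.KontsevichZagierPeriods.Zeta5Search.DualSeries (InBox)
open Summit.KontsevichZagierPeriods.Zeta5Search.WedgeDictionary (pfData)
open Summit.KontsevichZagierPeriods.Zeta5Search.CasoratianValuation (InPolytope)
open Summit.KontsevichZagierPeriods.Zeta5Search.ClusterValuation
open Summit.KontsevichZagierPeriods.Zeta5Search.PadicSeries
open Summit.KontsevichZagierPeriods.Zeta5Search.CellA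
open Literature.NumberTheory.Transcendental.BallRivoal (harm)

variable {p : ℕ} [hp : Fact p.Prime]

/-! ### §1 The type data of an exponent vector `e = (e₀, …, e_L)` -/

/-- `ρ^T_{i,σ}`: the coefficient of `ε^{n_i − σ}` (`n_i = −e_i`) in `∏_{j ≤ L, j ≠ i} (i − j + ε)^{e_j}` — the cofactor data of the
class function of the TYPE at its `i`-th point. -/
def typeRho (L : ℕ) (e : ℕ → ℤ) (i σ : ℕ) : ℚ :=
  coeff ((-e i).toNat - σ) (∏ j ∈ (range (L + 1)).erase i, binomSeries ((i : ℚ) - j) (e j))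

/-- `ŵ(T) := Σ_{poles i of order ≥ 3} ρ^T_{i,3}`. -/
def typeW (L : ℕ) (e : ℕ → ℤ) : ℚ :=
  ∑ i ∈ (range (L + 1)).filter (fun i => e i < 0), if e i ≤ -3 then typeRho L e i 3 else 0

/-- `v̂(T) := Σ_{poles i} Σ_{σ=1}^{n_i} (−1)^σ ρ^T_{i,σ} H^{(σ)}_i`. -/
def typeV (L : ℕ) (e : ℕ → ℤ) : ℚ :=
  ∑ i ∈ (range (L + 1)).filter (fun i => e i < 0), ∑ σ ∈ Icc 1 (-e i).toNat, (-1 : ℚ) ^ σ * typeRho L e i σ * harm σ i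

/-- `E(T) := Σ_{i ≤ L} e_i`. -/
def typeExp (L : ℕ) (e : ℕ → ℤ) : ℤ := ∑ i ∈ range (L + 1), e i

/-- `typeRho` only sees `e₀,…,e_L`. -/
theorem typeRho_congr {L : ℕ} {e e' : ℕ → ℤ} (h : ∀ k ≤ L, e k = e' k) {i : ℕ} (hi : i ≤ L) (σ : ℕ) :
    typeRho L e i σ = typeRho L e' i σ := by
  unfold typeRho
  rw [h i hi]
  congr 1
  refine prod_congr rfl fun j hj => ?_
  rw [h j (by have := mem_range.1 (mem_of_mem_erase hj); omega)]

/-- `typeW` only sees `e₀,…,e_L`. -/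
theorem typeW_congr {L : ℕ} {e e' : ℕ → ℤ} (h : ∀ k ≤ L, e k = e' k) : typeW L e = typeW L e' := by
  unfold typeW
  rw [filter_congr (fun i hi => by rw [h i (by have := mem_range.1 hi; omega)])]
  refine sum_congr rfl fun i hi => ?_
  have hiL : i ≤ L := by have := mem_range.1 (mem_filter.1 hi).1; omega
  rw [h i hiL, typeRho_congr h hiL]

/-- `typeV` only sees `e₀,…,e_L`. -/
theorem typeV_congr {L : ℕ} {e e' : ℕ → ℤ} (h : ∀ k ≤ L, e k = e' k) : typeV L e = typeV L e' := by
  unfold typeV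
  rw [filter_congr (fun i hi => by rw [h i (by have := mem_range.1 hi; omega)])]
  refine sum_congr rfl fun i hi => ?_
  have hiL : i ≤ L := by have := mem_range.1 (mem_filter.1 hi).1; omega
  rw [h i hiL]
  refine sum_congr rfl fun σ _ => ?_
  rw [typeRho_congr h hiL]

/-- `typeExp` only sees `e₀,…,e_L`. -/
theorem typeExp_congr {L : ℕ} {e e' : ℕ → ℤ} (h : ∀ k ≤ L, e k = e' k) : typeExp L e = typeExp L e' :=
  sum_congr rfl fun i hi => h i (by have := mem_range.1 hi; omega)

/-! ### §2 Level classes -/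

section Level

variable (b : ℕ → ℤ) {x L : ℕ} (hx : x < p) (hL : x + L * p ≤ (b 0).toNat) (hL' : (b 0).toNat < x + L * p + p)

omit hp in
/-- `k ↦ x + kp` is injective. -/
theorem level_injective (hp0 : 0 < p) (x : ℕ) : Function.Injective fun k : ℕ => x + k * p := by
  intro a c h
  have h' : a * p = c * p := by simp only at h; omega
  exact Nat.eq_of_mul_eq_mul_right hp0 h'

include hx hL hL' in
/-- **The class of a level class is `{x + kp : k ≤ L}`.** -/
theorem classSet_level : classSet b p x = (range (L + 1)).image fun k => x + k * p := by
  ext s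
  rw [mem_classSet_iff, mem_image]
  constructor
  · rintro ⟨hs, k, hk⟩
    have hp0 : (0 : ℤ) < p := by exact_mod_cast hp.out.pos
    have hk0 : 0 ≤ k := by
      by_contra h
      push Not at h
      have : (p : ℤ) * k ≤ (p : ℤ) * (-1) := mul_le_mul_of_nonneg_left (by omega) hp0.le
      omega
    have hkL : k ≤ L := by
      by_contra h
      push Not at h
      have h1 : (p : ℤ) * ((L : ℤ) + 1) ≤ (p : ℤ) * k := mul_le_mul_of_nonneg_left (by omega) hp0.le
      have h2 : (((b 0).toNat : ℕ) : ℤ) < ((x + L * p + p : ℕ) : ℤ) := by exact_mod_cast hL'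
      push_cast at h2
      have h3 : ((s : ℕ) : ℤ) ≤ (((b 0).toNat : ℕ) : ℤ) := by exact_mod_cast hs
      nlinarith
    refine ⟨k.toNat, mem_range.2 (by omega), ?_⟩
    have hkk : ((k.toNat : ℕ) : ℤ) = k := Int.toNat_of_nonneg hk0
    have e1 : ((x + k.toNat * p : ℕ) : ℤ) = s := by push_cast; rw [hkk]; linarith
    exact_mod_cast e1
  · rintro ⟨k, hk, rfl⟩
    rw [mem_range] at hk
    refine ⟨?_, k, by push_cast; ring⟩
    have : k * p ≤ L * p := Nat.mul_le_mul_right p (by omega)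
    omega

include hx hL hL' in
/-- The `i`-th point belongs to the class. -/
theorem level_mem {i : ℕ} (hi : i ≤ L) : x + i * p ∈ classSet b p x := by
  rw [classSet_level b hx hL hL']
  exact mem_image.2 ⟨i, mem_range.2 (by omega), rfl⟩

include hx hL hL' in
/-- **The class exponent of a centre-free level class is `E(T)`.** -/
theorem classExp_level (e : ℕ → ℤ) (he : ∀ k ≤ L, netExp b (x + k * p) = e k) (hc : ¬ CentreIn b p x) :
    classExp b p x = typeExp L e := by
  unfold classExp typeExp
  rw [if_neg (fun h => hc h.2), add_zero, classSet_level b hx hL hL', sum_image (fun a _ c _ h => level_injective hp.out.pos x h)]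
  exact sum_congr rfl fun k hk => he k (by have := mem_range.1 hk; omega)

include hx hL hL' in
/-- The pole set of a level class. -/
theorem classPoles_level (e : ℕ → ℤ) (he : ∀ k ≤ L, netExp b (x + k * p) = e k) :
    classPoles b p x = ((range (L + 1)).filter fun k => e k < 0).image fun k => x + k * p := by
  unfold classPoles
  rw [classSet_level b hx hL hL', filter_image]
  congr 1
  refine filter_congr fun k hk => ?_
  rw [he k (by have := mem_range.1 hk; omega)]

include hx hL hL' in
/-- **The cofactor of a centre-free level class at its `i`-th point is the type product `∏_{j ≠ i} (i − j + ε)^{e_j}`.** -/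
theorem classCofactor_level (e : ℕ → ℤ) (he : ∀ k ≤ L, netExp b (x + k * p) = e k) (hc : ¬ CentreIn b p x) {i : ℕ}
    (hi : i ≤ L) : classCofactor b p (x + i * p) = ∏ j ∈ (range (L + 1)).erase i, binomSeries ((i : ℚ) - j) (e j) := by
  have hq := level_mem b hx hL hL' hi
  have hp0 : (p : ℚ) ≠ 0 := Nat.cast_ne_zero.2 hp.out.ne_zero
  unfold classCofactor
  rw [if_neg (fun h => hc ((centreIn_iff_of_mem hq).1 h.2)), mul_one, classSet_eq_of_mem hq, classSet_level b hx hL hL',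
    ← image_erase (level_injective hp.out.pos x), prod_image (fun a _ c _ h => level_injective hp.out.pos x h)]
  refine prod_congr rfl fun j hj => ?_
  have hjL : j ≤ L := by have := mem_range.1 (mem_of_mem_erase hj); omega
  rw [he j hjL]
  congr 1
  rw [div_eq_iff hp0]
  push_cast
  ring

include hx hL hL' in
/-- **`ρ_{x+ip, σ} = ρ^T_{i,σ}`.** -/
theorem classRho_level (e : ℕ → ℤ) (he : ∀ k ≤ L, netExp b (x + k * p) = e k) (hc : ¬ CentreIn b p x) {i : ℕ}
    (hi : i ≤ L) (σ : ℕ) : classRho b p (x + i * p) σ = typeRho L e i σ := by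
  unfold classRho typeRho
  rw [classCofactor_level b hx hL hL' e he hc hi, he i hi]

include hx hL hL' in
/-- **`ŵ_x = ŵ(T)`.** -/
theorem wHat_level (e : ℕ → ℤ) (he : ∀ k ≤ L, netExp b (x + k * p) = e k) (hc : ¬ CentreIn b p x) :
    wHat b p x = typeW L e := by
  unfold wHat typeW
  rw [classPoles_level b hx hL hL' e he, sum_image (fun a _ c _ h => level_injective hp.out.pos x h)]
  refine sum_congr rfl fun k hk => ?_
  have hkL : k ≤ L := by have := mem_range.1 (mem_filter.1 hk).1; omega
  rw [he k hkL, classRho_level b hx hL hL' e he hc hkL]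

include hx hL hL' in
/-- **`v̂_x = v̂(T)`** (the level of `x + kp` is `k`). -/
theorem vHat_level (e : ℕ → ℤ) (he : ∀ k ≤ L, netExp b (x + k * p) = e k) (hc : ¬ CentreIn b p x) :
    vHat b p x = typeV L e := by
  unfold vHat typeV
  rw [classPoles_level b hx hL hL' e he, sum_image (fun a _ c _ h => level_injective hp.out.pos x h)]
  refine sum_congr rfl fun k hk => ?_
  have hkL : k ≤ L := by have := mem_range.1 (mem_filter.1 hk).1; omega
  have hlev : (x + k * p) / p = k := by
    rw [Nat.add_mul_div_right _ _ hp.out.pos, Nat.div_eq_of_lt hx, zero_add]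
  rw [he k hkL, hlev]
  refine sum_congr rfl fun σ _ => ?_
  rw [classRho_level b hx hL hL' e he hc hkL]

/-! ### §3 Integrality of the digits and the unit -/

include hL in
omit hp in
/-- Every point of a level class lies below `b₀`. -/
theorem level_le {i : ℕ} (hi : i ≤ L) : x + i * p ≤ (b 0).toNat := by
  have : i * p ≤ L * p := Nat.mul_le_mul_right p hi
  omega

/-- `‖ŵ_x‖ ≤ 1` (the `ρ`'s are `p`-integral in the window). -/
theorem padicNorm_wHat_le_one (h0 : 0 ≤ b 0) (hn : (b 0).toNat < p ^ 2) (hp2 : p ≠ 2) (x : ℕ) :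
    padicNorm p (wHat b p x) ≤ 1 := by
  unfold wHat
  refine padicNorm.sum_le' (fun q hq => ?_) zero_le_one
  have hqN : q ≤ (b 0).toNat := ((mem_classSet_iff b x q).1 (mem_filter.1 hq).1).1
  split_ifs
  · exact padicNorm_classRho_le_one b h0 hqN hn hp2 3
  · rw [padicNorm.zero]; exact zero_le_one

/-- `‖v̂_x‖ ≤ 1` (also the harmonic numbers `H^{(σ)}_ℓ`, `ℓ < p`, are `p`-integral). -/
theorem padicNorm_vHat_le_one (h0 : 0 ≤ b 0) (hn : (b 0).toNat < p ^ 2) (hp2 : p ≠ 2) :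
    padicNorm p (vHat b p x) ≤ 1 := by
  unfold vHat
  refine padicNorm.sum_le' (fun q hq => padicNorm.sum_le' (fun σ _ => ?_) zero_le_one) zero_le_one
  have hqN : q ≤ (b 0).toNat := ((mem_classSet_iff b x q).1 (mem_filter.1 hq).1).1
  have hlp : q / p < p := Nat.div_lt_of_lt_mul (by nlinarith [hqN, hn])
  rw [padicNorm.mul, padicNorm.mul, padicNorm_pow_eq, padicNorm.neg, padicNorm.one, one_pow, one_mul]
  calc padicNorm p (classRho b p q σ) * padicNorm p (harm σ (q / p)) ≤ 1 * 1 :=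
        mul_le_mul (padicNorm_classRho_le_one b h0 hqN hn hp2 σ) (padicNorm_harm_le_one hlp σ) (padicNorm.nonneg _)
          zero_le_one
    _ = 1 := one_mul _

/-- `‖ĝ_q‖ ≤ 1` for a class point (G1: `v_p(ĝ_q) = 0`). -/
theorem padicNorm_gHat_le_one (hb : InPolytope b) (hp5 : 5 ≤ p) (hx : x < p) {q : ℕ} (hq : q ∈ classSet b p x) :
    padicNorm p (gHat b p q) ≤ 1 := by
  by_cases h0 : gHat b p q = 0
  · rw [h0, padicNorm.zero]; exact zero_le_one
  · have := (gHat_classCongr b p x q q hb hp.out hp5 hx hq hq).1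
    rw [padicNorm.eq_zpow_of_nonzero h0, this]; simp

/-- G1 in norm form: `‖ĝ_q − ĝ_{q'}‖ ≤ p⁻¹` on a class. -/
theorem padicNorm_gHat_sub_le (hb : InPolytope b) (hp5 : 5 ≤ p) (hx : x < p) {q q' : ℕ} (hq : q ∈ classSet b p x)
    (hq' : q' ∈ classSet b p x) : padicNorm p (gHat b p q - gHat b p q') ≤ (p : ℚ) ^ (-(1 : ℤ)) :=
  padicNorm_le_of_val fun hne => (gHat_classCongr b p x q q' hb hp.out hp5 hx hq hq').2 (sub_ne_zero.1 hne)

/-- Replacing the unit by a congruent one in a digit statement. -/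
theorem digit_swap {X g g' w : ℚ} (h : padicNorm p (X - g * w) ≤ (p : ℚ) ^ (-(1 : ℤ)))
    (hg : padicNorm p (g - g') ≤ (p : ℚ) ^ (-(1 : ℤ))) (hw : padicNorm p w ≤ 1) :
    padicNorm p (X - g' * w) ≤ (p : ℚ) ^ (-(1 : ℤ)) := by
  have e : X - g' * w = (X - g * w) + w * (g - g') := by ring
  rw [e]; exact small_add h (small_mul hw hg)

/-! ### §4 The normalised first digits of a level class -/

/-- `‖(−p)^a‖ = p^{−a}`. -/
theorem padicNorm_neg_p_zpow (a : ℤ) : padicNorm p ((-(p : ℚ)) ^ a) = (p : ℚ) ^ (-a) := by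
  have hp' : (-(p : ℚ)) ≠ 0 := neg_ne_zero.2 (Nat.cast_ne_zero.2 hp.out.ne_zero)
  rw [padicNorm.eq_zpow_of_nonzero (zpow_ne_zero _ hp'), padicValRat.zpow, padicValRat.neg,
    padicValRat.self hp.out.one_lt, mul_one]

/-- Normalising a valuation statement: `‖D‖ ≤ p^{−(a+1)}` gives `‖(−p)^{−a} · D‖ ≤ p⁻¹`. -/
theorem padicNorm_normalise {D : ℚ} {a : ℤ} (h : padicNorm p D ≤ (p : ℚ) ^ (-(a + 1))) :
    padicNorm p ((-(p : ℚ)) ^ (-a) * D) ≤ (p : ℚ) ^ (-(1 : ℤ)) := by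
  have hp0 : (p : ℚ) ≠ 0 := Nat.cast_ne_zero.2 hp.out.ne_zero
  rw [padicNorm.mul, padicNorm_neg_p_zpow, neg_neg]
  calc (p : ℚ) ^ a * padicNorm p D ≤ (p : ℚ) ^ a * (p : ℚ) ^ (-(a + 1)) :=
        mul_le_mul_of_nonneg_left h (zpow_p_nonneg _)
    _ = (p : ℚ) ^ (-(1 : ℤ)) := by rw [← zpow_add₀ hp0]; ring_nf

include hx hL hL' in
/-- **The `W`-digit of a level class, normalised**: `‖(−p)^{−(E+3)}·W_x − g·ŵ(T)‖ ≤ p⁻¹` for every `g ≡ ĝ_x (mod p)`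
(P1 g5's `wDigit` = gen-2 g9's U-W, plus type invariance). -/
theorem w_digit_level (hb : InPolytope b) (hp5 : 5 ≤ p) (hwin : (b 0 + 2 : ℤ) < (p : ℤ) ^ 2) (e : ℕ → ℤ)
    (he : ∀ k ≤ L, netExp b (x + k * p) = e k) (hc : ¬ CentreIn b p x) {i₀ : ℕ} (hi₀ : i₀ ≤ L) (hneg : e i₀ < 0)
    {g : ℚ} (hg : padicNorm p (gHat b p x - g) ≤ (p : ℚ) ^ (-(1 : ℤ))) :
    padicNorm p ((-(p : ℚ)) ^ (-(typeExp L e + 3)) * classW b p x - g * typeW L e) ≤ (p : ℚ) ^ (-(1 : ℤ)) := by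
  obtain ⟨hbox, -, -, hn⟩ := thmA_data b hb hwin
  have hp2 : p ≠ 2 := by have := hp.out.two_le; omega
  have hp' : (-(p : ℚ)) ≠ 0 := neg_ne_zero.2 (Nat.cast_ne_zero.2 hp.out.ne_zero)
  have hq := level_mem b hx hL hL' hi₀
  have hx0 : x ∈ classSet b p x := by simpa using level_mem b hx hL hL' (Nat.zero_le L)
  have hpole : netExp b (x + i₀ * p) < 0 := by rw [he i₀ hi₀]; exact hneg
  have hE := classExp_level b hx hL hL' e he hc
  have hw := wHat_level b hx hL hL' e he hc
  set E := typeExp L e with hEdef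
  -- `wDigit` at the pole `x + i₀ p`
  have hD : padicNorm p (classW b p x - (-(p : ℚ)) ^ (E + 3) * gHat b p (x + i₀ * p) * wHat b p x) ≤
      (p : ℚ) ^ (-(E + 3 + 1)) := by
    refine padicNorm_le_of_val fun hne => ?_
    have := wDigit b p x (x + i₀ * p) hb hp.out hp5 hwin hx hq hpole (by rw [hE]; exact hne)
    rw [hE] at this
    unfold classW
    linarith
  have h1 : padicNorm p ((-(p : ℚ)) ^ (-(E + 3)) * classW b p x - gHat b p (x + i₀ * p) * wHat b p x) ≤
      (p : ℚ) ^ (-(1 : ℤ)) := by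
    have e1 : (-(p : ℚ)) ^ (-(E + 3)) * classW b p x - gHat b p (x + i₀ * p) * wHat b p x =
        (-(p : ℚ)) ^ (-(E + 3)) * (classW b p x - (-(p : ℚ)) ^ (E + 3) * gHat b p (x + i₀ * p) * wHat b p x) := by
      rw [mul_sub, show (-(p : ℚ)) ^ (-(E + 3)) * ((-(p : ℚ)) ^ (E + 3) * gHat b p (x + i₀ * p) * wHat b p x) =
        ((-(p : ℚ)) ^ (-(E + 3)) * (-(p : ℚ)) ^ (E + 3)) * (gHat b p (x + i₀ * p) * wHat b p x) by ring,
        ← zpow_add₀ hp', neg_add_cancel, zpow_zero, one_mul]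
    rw [e1]
    exact padicNorm_normalise hD
  rw [← hw]
  refine digit_swap h1 ?_ (padicNorm_wHat_le_one b hbox.1 hn hp2 x)
  have e2 : gHat b p (x + i₀ * p) - g = (gHat b p (x + i₀ * p) - gHat b p x) + (gHat b p x - g) := by ring
  rw [e2]; exact small_add (padicNorm_gHat_sub_le b hb hp5 hx hq hx0) hg

include hx hL hL' in
/-- **The `V`-digit of a level class, normalised**: `‖(−p)^{−E}·V_x − g·v̂(T)‖ ≤ p⁻¹` for every `g ≡ ĝ_x (mod p)`
(P1 g5's `vDigit` = gen-2 g9's U-V, plus type invariance). -/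
theorem v_digit_level (hb : InPolytope b) (hp5 : 5 ≤ p) (hwin : (b 0 + 2 : ℤ) < (p : ℤ) ^ 2) (e : ℕ → ℤ)
    (he : ∀ k ≤ L, netExp b (x + k * p) = e k) (hc : ¬ CentreIn b p x) {i₀ : ℕ} (hi₀ : i₀ ≤ L) (hneg : e i₀ < 0)
    {g : ℚ} (hg : padicNorm p (gHat b p x - g) ≤ (p : ℚ) ^ (-(1 : ℤ))) :
    padicNorm p ((-(p : ℚ)) ^ (-typeExp L e) * classV b p x - g * typeV L e) ≤ (p : ℚ) ^ (-(1 : ℤ)) := by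
  obtain ⟨hbox, -, -, hn⟩ := thmA_data b hb hwin
  have hp2 : p ≠ 2 := by have := hp.out.two_le; omega
  have hp' : (-(p : ℚ)) ≠ 0 := neg_ne_zero.2 (Nat.cast_ne_zero.2 hp.out.ne_zero)
  have hq := level_mem b hx hL hL' hi₀
  have hx0 : x ∈ classSet b p x := by simpa using level_mem b hx hL hL' (Nat.zero_le L)
  have hpole : netExp b (x + i₀ * p) < 0 := by rw [he i₀ hi₀]; exact hneg
  have hE := classExp_level b hx hL hL' e he hc
  have hv := vHat_level b hx hL hL' e he hc
  set E := typeExp L e with hEdef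
  have hD : padicNorm p (classV b p x - (-(p : ℚ)) ^ E * gHat b p (x + i₀ * p) * vHat b p x) ≤
      (p : ℚ) ^ (-(E + 1)) := by
    refine padicNorm_le_of_val fun hne => ?_
    have := vDigit b p x (x + i₀ * p) hb hp.out hp5 hwin hx hq hpole (by rw [hE]; exact hne)
    rw [hE] at this
    linarith
  have h1 : padicNorm p ((-(p : ℚ)) ^ (-E) * classV b p x - gHat b p (x + i₀ * p) * vHat b p x) ≤
      (p : ℚ) ^ (-(1 : ℤ)) := by
    have e1 : (-(p : ℚ)) ^ (-E) * classV b p x - gHat b p (x + i₀ * p) * vHat b p x =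
        (-(p : ℚ)) ^ (-E) * (classV b p x - (-(p : ℚ)) ^ E * gHat b p (x + i₀ * p) * vHat b p x) := by
      rw [mul_sub, show (-(p : ℚ)) ^ (-E) * ((-(p : ℚ)) ^ E * gHat b p (x + i₀ * p) * vHat b p x) =
        ((-(p : ℚ)) ^ (-E) * (-(p : ℚ)) ^ E) * (gHat b p (x + i₀ * p) * vHat b p x) by ring,
        ← zpow_add₀ hp', neg_add_cancel, zpow_zero, one_mul]
    rw [e1]
    exact padicNorm_normalise hD
  rw [← hv]
  refine digit_swap h1 ?_ (padicNorm_vHat_le_one b hbox.1 hn hp2)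
  have e2 : gHat b p (x + i₀ * p) - g = (gHat b p (x + i₀ * p) - gHat b p x) + (gHat b p x - g) := by ring
  rw [e2]; exact small_add (padicNorm_gHat_sub_le b hb hp5 hx hq hx0) hg

include hx hL hL' in
/-- **The unit of the conjugate class**: `ĝ_{b₀ − (x + Lp)} = (−1)^{E+1}·ĝ_{x+Lp}` exactly (G2), hence
`‖ĝ_{b₀−(x+Lp)} − (−1)^{E+1}ĝ_x‖ ≤ p⁻¹` (G1). -/
theorem gHat_conj_level (hb : InPolytope b) (hp5 : 5 ≤ p) (e : ℕ → ℤ) (he : ∀ k ≤ L, netExp b (x + k * p) = e k)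
    (hc : ¬ CentreIn b p x) :
    padicNorm p (gHat b p ((b 0).toNat - (x + L * p)) - (-1 : ℚ) ^ (typeExp L e + 1) * gHat b p x) ≤
      (p : ℚ) ^ (-(1 : ℤ)) := by
  have hq := level_mem b hx hL hL' le_rfl
  have hx0 : x ∈ classSet b p x := by simpa using level_mem b hx hL hL' (Nat.zero_le L)
  rw [gHat_conj b p x (x + L * p) hb hp.out hp5 hx hc hq, classExp_level b hx hL hL' e he hc, ← mul_sub, padicNorm.mul,
    padicNorm_zpow_unit (by rw [padicNorm.neg, padicNorm.one]) _, one_mul]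
  exact padicNorm_gHat_sub_le b hb hp5 hx hq hx0

end Level

end Summit.KontsevichZagierPeriods.Zeta5Search.LevelClass

end
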